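import Summits.AtomisticToContinuum.Crystallization.Theorems.HullExactificationCascadeRobustBarlowTemplateTransportSteps1
import Summits.AtomisticToContinuum.Crystallization.Theorems.HullExactificationCascadeRobustBarlowTemplateTransportSteps2
import Summits.AtomisticToContinuum.Crystallization.Theorems.HullExactificationCascadeRobustBarlowTemplateTransportSteps3
import Summits.AtomisticToContinuum.Crystallization.Theorems.HullExactificationCascadeRobustBarlowTemplateTransportSteps7
import Summits.AtomisticToContinuum.Crystallization.Theorems.HullExactificationCascadeRobustBarlowTemplateTransportAttach1
import Summits.AtomisticToContinuum.Crystallization.Theorems.HullExactificationCascadeRobustBarlowTemplateTransportAttach2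
import Summits.AtomisticToContinuum.Crystallization.Theorems.HullExactificationCascadeRobustBarlowTemplateTransportComm1
import Summits.AtomisticToContinuum.Crystallization.Theorems.PalmUnimodularRigidityShellsToBarlowChartTransportComm2

/-!
# Line `registered` (crux `RobustBarlowTemplate`, stmt-AtomisticToContinuum-12088): commutation of `V` with `I` and `J` (part 2/3)

Helper lemmas for `develop_transport` (the geometric half of the development): frames
`⟨x, t₁, t₂, U⟩` read in the scale-relative integer charts `IsZChart` of an everywhere-good
configuration, their transports and the coherence of the resulting development `frameAt`.  The
only metric inputs are the chart transfer lemma `develop_transfer` and `bond_nb_iff`; everything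
else is label combinatorics in `ℤ³` (pattern facts `TransportPatterns*` of the sibling crux 9227,
imported verbatim).  All `[folklore]` (HalesDSP2012 §1.3 for the two kissing patterns).

PORT of `PalmUnimodularRigidityShellsToBarlowChartTransportComm2.lean` of the closed sibling crux
`ShellsToBarlowChart` (stmt-9227) to the SCALE-RELATIVE shell relation `y ∈ shell S x` of this
crux (in place of the bond window `0 < dist x y ∧ dist x y ≤ 28/25`) and to the five-argument
charts `IsZChart S x P A nbr`; the port rules (conjunct paths, `bond a b ↦ b ∈ shell S a`, the
threaded symmetry hypothesis `hsy : ∀ x ∈ S, ∀ y ∈ shell S x, x ∈ shell S y` replacing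
`bond_symm`, `zchart_transfer` / `zchart_sqNormInt_eq` replacing `sqNormInt_transfer` /
`IsZChart.sqNormInt_eq`, the `open … hiding …` line) are listed under "Port notes" in
`…RobustBarlowTemplateTransportSteps1.lean` (and its extensions in `…TransportSteps6.lean`,
`…TransportAttach1.lean`, `…TransportComm1.lean`).

## Port notes (this part: `TransportComm2`)
* the five CHART-AGNOSTIC lemmas of the source part (`ZFrame.ext'`, `swap_hyps`, `sqNormInt_zero`,
  `cross_dist`, `capOpp_lower`: pure `ℤ³` / `OpsDefs` statements, no chart hypothesis) are NOT
  re-proved (the gate forbids restating landed declarations): they are used from the source module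
  `…ShellsToBarlowChartTransportComm2`, imported for that purpose (as are `hregI_of_valid`,
  `hregJ_of_valid` of the 9227 `Comm1`, see our `…TransportComm1`); only the two chart-dependent
  lemmas `Vstep_Istep_side`, `Vstep_Jstep_pt` are ported, with `hsy` inserted right after `hch`
  (passed on to `Istep_spec`, `Jstep_spec`, `Vstep_spec`, `attach_I_even/odd`, `attach_J_even/odd`,
  `Vstep_Istep_pt`, `transfer_nb_nb`, `transfer_nb_centre`); the bond conjuncts in the two
  conclusions became the shell memberships
  `(Vstep Pc nb (Jstep Pc nb g)).pt ∈ shell S (Vstep Pc nb (Istep Pc nb g)).pt` resp.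
  `(Vstep Pc nb (Jstep Pc nb g)).pt ∈ shell S (Vstep Pc nb g).pt` (same positions), the bonds
  inside the proofs became shell memberships; otherwise the proofs are the source proofs verbatim
  (no `bond_symm` and no metric constant occurs in this part);
* imports: our parts 1, 2, 3, 7, `Attach1`, `Attach2`, `Comm1` (as in the source) and the 9227
  `Comm2`; since the latter makes the 9227 parts `Attach2`, `Comm1`, `Comm2` visible too, the
  `open … hiding …` line of our `…TransportComm1` is EXTENDED by the chart-dependent 9227 names
  redeclared in our `Attach2` and here (`attach_lower_I_pos`, `attach_lower_I_neg`,
  `attach_J_even`, `attach_J_odd`, `Vstep_Istep_side`, `Vstep_Jstep_pt`) — copy this longer line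
  into later parts;
* the anchor at the end (explicit-`∀` form, registered sub-goal) is new.
-/

noncomputable section

namespace Summit.AtomisticToContinuum.Crystallization.Theorems.HullExactificationCascadeRobustBarlowTemplate

open Literature.Geometry.DiscreteGeometry Literature.MathematicalPhysics.StatisticalMechanics
open Summit.AtomisticToContinuum.Crystallization.Theorems.PalmUnimodularRigidityShellsToBarlowChart hiding
  IsZChart TransportSystem scales_tied sqNormInt_transfer bond_symm nb_mem zlab_spec zlab_nb bond_nb_iff
  pattern_cases transfer_nb_nb transfer_nb_centre transfer_nb_target sqNormInt_zlab_centre hcp_of_mirror_pair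
  Istep_spec Jstep_spec IinvStep_spec JinvStep_spec capWithAny_of_mem_cap IinvStep_Istep Istep_IinvStep
  JinvStep_Jstep Jstep_JinvStep polar_at_apex onesided_at_apex nb_inj Istep_lower Jstep_lower
  IinvStep_lower JinvStep_lower Vstep_spec polar_at_lower_apex onesided_at_lower_apex VinvStep_spec
  attach_I_even attach_I_odd Vstep_Istep_pt Vstep_Istep_back attach_lower_I_pos attach_lower_I_neg
  attach_J_even attach_J_odd Vstep_Istep_side Vstep_Jstep_pt

variable {S : Set (EuclideanSpace ℝ (Fin 3))} {Pc : (EuclideanSpace ℝ (Fin 3)) → Finset (Fin 3 → ℤ)}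
  {Ac : (EuclideanSpace ℝ (Fin 3)) → ((EuclideanSpace ℝ (Fin 3)) →ₗᵢ[ℝ] (EuclideanSpace ℝ (Fin 3)))}
  {nb : (EuclideanSpace ℝ (Fin 3)) → (Fin 3 → ℤ) → (EuclideanSpace ℝ (Fin 3))}

/-- **`V ∘ I = I ∘ V`, the second direction.**  With `u' = (V (I g)).pt` and `uJ = (V (J g)).pt`,
the label of `uJ` at `u'` is `(V (I g)).t₂ − (V (I g)).t₁`: in the model `uJ = (k+1, i, j+1)` is
the `(t₂ − t₁)`-neighbour of `u' = (k+1, i+1, j)`.  Needs the in-layer commutation at `g`.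
[folklore] -/
theorem Vstep_Istep_side (hch : ∀ z ∈ S, IsZChart S z (Pc z) (Ac z) (nb z))
    (hsy : ∀ x ∈ S, ∀ y ∈ shell S x, x ∈ shell S y) {x : (EuclideanSpace ℝ (Fin 3))}
    (hx : x ∈ S) {t₁ t₂ : Fin 3 → ℤ} {U : Finset (Fin 3 → ℤ)} (hU : IsFrame (Pc x) t₁ t₂ U)
    (hI : IsFrame (Pc (nb x t₁)) (Istep Pc nb ⟨x, t₁, t₂, U⟩).t₁ (Istep Pc nb ⟨x, t₁, t₂, U⟩).t₂
      (Istep Pc nb ⟨x, t₁, t₂, U⟩).U)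
    (hJ : IsFrame (Pc (nb x t₂)) (Jstep Pc nb ⟨x, t₁, t₂, U⟩).t₁ (Jstep Pc nb ⟨x, t₁, t₂, U⟩).t₂
      (Jstep Pc nb ⟨x, t₁, t₂, U⟩).U)
    (hIi : IsFrame (Pc (nb x (-t₁))) (IinvStep Pc nb ⟨x, t₁, t₂, U⟩).t₁
      (IinvStep Pc nb ⟨x, t₁, t₂, U⟩).t₂ (IinvStep Pc nb ⟨x, t₁, t₂, U⟩).U)
    (hJi : IsFrame (Pc (nb x (-t₂))) (JinvStep Pc nb ⟨x, t₁, t₂, U⟩).t₁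
      (JinvStep Pc nb ⟨x, t₁, t₂, U⟩).t₂ (JinvStep Pc nb ⟨x, t₁, t₂, U⟩).U)
    (hII : IsFrame (Pc (nb (nb x t₁) (Istep Pc nb ⟨x, t₁, t₂, U⟩).t₁))
      (Istep Pc nb (Istep Pc nb ⟨x, t₁, t₂, U⟩)).t₁ (Istep Pc nb (Istep Pc nb ⟨x, t₁, t₂, U⟩)).t₂
      (Istep Pc nb (Istep Pc nb ⟨x, t₁, t₂, U⟩)).U)
    (hJI : IsFrame (Pc (nb (nb x t₁) (Istep Pc nb ⟨x, t₁, t₂, U⟩).t₂))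
      (Jstep Pc nb (Istep Pc nb ⟨x, t₁, t₂, U⟩)).t₁ (Jstep Pc nb (Istep Pc nb ⟨x, t₁, t₂, U⟩)).t₂
      (Jstep Pc nb (Istep Pc nb ⟨x, t₁, t₂, U⟩)).U)
    (hIiI : IsFrame (Pc (nb (nb x t₁) (-(Istep Pc nb ⟨x, t₁, t₂, U⟩).t₁)))
      (IinvStep Pc nb (Istep Pc nb ⟨x, t₁, t₂, U⟩)).t₁ (IinvStep Pc nb (Istep Pc nb ⟨x, t₁, t₂, U⟩)).t₂
      (IinvStep Pc nb (Istep Pc nb ⟨x, t₁, t₂, U⟩)).U)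
    (hJiI : IsFrame (Pc (nb (nb x t₁) (-(Istep Pc nb ⟨x, t₁, t₂, U⟩).t₂)))
      (JinvStep Pc nb (Istep Pc nb ⟨x, t₁, t₂, U⟩)).t₁ (JinvStep Pc nb (Istep Pc nb ⟨x, t₁, t₂, U⟩)).t₂
      (JinvStep Pc nb (Istep Pc nb ⟨x, t₁, t₂, U⟩)).U)
    (hcomm : Istep Pc nb (Jstep Pc nb ⟨x, t₁, t₂, U⟩) = Jstep Pc nb (Istep Pc nb ⟨x, t₁, t₂, U⟩)) :
    zlab Pc nb (Vstep Pc nb (Istep Pc nb ⟨x, t₁, t₂, U⟩)).pt (Vstep Pc nb (Jstep Pc nb ⟨x, t₁, t₂, U⟩)).pt =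
        (Vstep Pc nb (Istep Pc nb ⟨x, t₁, t₂, U⟩)).t₂ - (Vstep Pc nb (Istep Pc nb ⟨x, t₁, t₂, U⟩)).t₁ ∧
      (Vstep Pc nb (Jstep Pc nb ⟨x, t₁, t₂, U⟩)).pt ∈ shell S (Vstep Pc nb (Istep Pc nb ⟨x, t₁, t₂, U⟩)).pt := by
  have hregI := hregI_of_valid (Pc := Pc) (nb := nb) hI
  have hregJ := hregJ_of_valid (Pc := Pc) (nb := nb) hJ
  obtain ⟨hyS, hbxy, hwP, hwx, hvP, hvnb, -, -, -, hκ, -, hframe, hparI, -⟩ := Istep_spec hch hsy hx hU hregI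
  obtain ⟨hyJS, -, -, -, -, -, -, -, -, -, -, hJframe, hparJ, -⟩ := Jstep_spec hch hsy hx hU hregJ
  obtain ⟨hcU, huS, hbu, hξP, hξx, hframeV, -, hbr⟩ := Vstep_spec hch hsy hx hU hI hJ hIi hJi
  have hPx := pattern_cases hch hx
  have hPy := pattern_cases hch hyS
  obtain ⟨h12, hhex, hUP, -, -⟩ := id hU
  have ht₁ : t₁ ∈ Pc x := hhex (mem_hexLabels_iff.2 (Or.inl rfl))
  have ht₂ : t₂ ∈ Pc x := hhex (mem_hexLabels_iff.2 (Or.inr (Or.inl rfl)))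
  have ht12 : t₁ - t₂ ∈ Pc x :=
    hhex (mem_hexLabels_iff.2 (Or.inr (Or.inr (Or.inr (Or.inr (Or.inr rfl))))))
  set c := apexOf t₁ t₂ U with hc_def
  have hcP : c ∈ Pc x := hUP hcU
  -- the frames `I g = ⟨y, a', b', U'⟩` and `J g = ⟨yJ, aJ, bJ, UJ⟩`
  set a' := (Istep Pc nb ⟨x, t₁, t₂, U⟩).t₁ with ha'
  set b' := (Istep Pc nb ⟨x, t₁, t₂, U⟩).t₂ with hb'
  set U' := (Istep Pc nb ⟨x, t₁, t₂, U⟩).U with hU'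
  have hIeq : Istep Pc nb ⟨x, t₁, t₂, U⟩ = ⟨nb x t₁, a', b', U'⟩ := rfl
  set aJ := (Jstep Pc nb ⟨x, t₁, t₂, U⟩).t₁ with haJ
  set bJ := (Jstep Pc nb ⟨x, t₁, t₂, U⟩).t₂ with hbJ_def
  set UJ := (Jstep Pc nb ⟨x, t₁, t₂, U⟩).U with hUJ
  have hJeq : Jstep Pc nb ⟨x, t₁, t₂, U⟩ = ⟨nb x t₂, aJ, bJ, UJ⟩ := rfl
  rw [hIeq] at hII hJI hIiI hJiI hcomm ⊢
  rw [hJeq] at hcomm ⊢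
  obtain ⟨hc'U, hu'S, hbu', hξ'P, hξ'x, hframeV', -, hbr'⟩ :=
    Vstep_spec hch hsy hyS hframe hII hJI hIiI hJiI
  obtain ⟨h12', hhex', hUP', -, -⟩ := id hframe
  have ha'P : a' ∈ Pc (nb x t₁) := hhex' (mem_hexLabels_iff.2 (Or.inl rfl))
  have hb'P : b' ∈ Pc (nb x t₁) := hhex' (mem_hexLabels_iff.2 (Or.inr (Or.inl rfl)))
  set c' := apexOf a' b' U' with hc'_def
  have hc'P : c' ∈ Pc (nb x t₁) := hUP' hc'U
  have hV'pt : (Vstep Pc nb ⟨nb x t₁, a', b', U'⟩).pt = nb (nb x t₁) c' := rfl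
  rw [hV'pt] at *
  set u' := nb (nb x t₁) c' with hu'_def
  set t₁'' := (Vstep Pc nb ⟨nb x t₁, a', b', U'⟩).t₁ with ht₁''_def
  set t₂'' := (Vstep Pc nb ⟨nb x t₁, a', b', U'⟩).t₂ with ht₂''_def
  have hPu' := pattern_cases hch hu'S
  obtain ⟨h12'', hhex'', -, -, -⟩ := id hframeV'
  have ht21P : t₂'' - t₁'' ∈ Pc u' := hhex'' (mem_hexLabels_iff.2 (Or.inr (Or.inr (Or.inl rfl))))
  have Dt12 : sqNormInt (t₁'' - t₂'') = 18 := h12''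
  -- the point `uJ = (V (J g)).pt`
  set cJ := apexOf aJ bJ UJ with hcJ_def
  have hVJpt : (Vstep Pc nb ⟨nb x t₂, aJ, bJ, UJ⟩).pt = nb (nb x t₂) cJ := rfl
  rw [hVJpt]
  rcases hbr with ⟨hpar, -, -, -, -⟩ | ⟨hpar, -, -, -, -⟩
  · /- EVEN: everything is read in the chart of `x'' = JIx = nb y b'` -/
    have hpar' : frameParity a' b' U' = 1 := hparI.trans hpar
    have hparJ' : frameParity aJ bJ UJ = 1 := hparJ.trans hpar
    rcases hbr' with ⟨-, hL', hnI', hnJ', -⟩ | ⟨hpar'', -, -, -, -⟩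
    swap
    · rw [hpar'] at hpar''; norm_num at hpar''
    -- the frame `J (I g) = ⟨x'', a'', b'', U''⟩`
    set a'' := (Jstep Pc nb ⟨nb x t₁, a', b', U'⟩).t₁ with ha''
    set b'' := (Jstep Pc nb ⟨nb x t₁, a', b', U'⟩).t₂ with hb''
    set U'' := (Jstep Pc nb ⟨nb x t₁, a', b', U'⟩).U with hU''
    have hJIeq : Jstep Pc nb ⟨nb x t₁, a', b', U'⟩ = ⟨nb (nb x t₁) b', a'', b'', U''⟩ := rfl
    have hregJI := hregJ_of_valid (Pc := Pc) (nb := nb) hJI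
    obtain ⟨hx''S, hbyx'', hw''P, hw''y, hv''P, hv''nb, -, -, -, -, -, hframe'', hpar''I, -⟩ :=
      Jstep_spec hch hsy hyS hframe hregJI
    have hpar''' : frameParity a'' b'' U'' = 1 := hpar''I.trans hpar'
    have hPx'' := pattern_cases hch hx''S
    obtain ⟨h12x, hhexx, -, -, -⟩ := id hframe''
    have ha''P : a'' ∈ Pc (nb (nb x t₁) b') := hhexx (mem_hexLabels_iff.2 (Or.inl rfl))
    have hb''P : b'' ∈ Pc (nb (nb x t₁) b') := hhexx (mem_hexLabels_iff.2 (Or.inr (Or.inl rfl)))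
    obtain ⟨-, hc''P, hc''off, hc1'', hc2'', hE''⟩ := even_form_of_parity hPx'' hframe'' hpar'''
    set c'' := apexOf a'' b'' U'' with hc''_def
    -- `u' = nb x'' (c'' − b'')`
    obtain ⟨hattJ, hlabJ⟩ := attach_J_even hch hsy hyS hframe hpar' hregJI
    rw [hJIeq] at hattJ hlabJ
    have hu'x'' : nb (nb (nb x t₁) b') (c'' - b'') = u' := hattJ
    -- `uJ = nb x'' (c'' − a'')` through the in-layer commutation
    have hpteq : nb (nb x t₂) aJ = nb (nb x t₁) b' := congrArg ZFrame.pt hcomm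
    have hregIJ : Pc (nb (nb x t₂) aJ) = fcc3Int ∨ Pc (nb x t₂) = hcpInt ∨
        (-zlab Pc nb (nb (nb x t₂) aJ) (nb x t₂) ∈ Pc (nb (nb x t₂) aJ) ∧
          -zlab Pc nb (nb (nb x t₂) aJ) (nb (nb x t₂) bJ) ∈ Pc (nb (nb x t₂) aJ)) := by
      apply hregI_of_valid (Pc := Pc) (nb := nb)
      rw [hcomm, hpteq]; exact hJI
    obtain ⟨hattI, hlabI⟩ := attach_I_even hch hsy hyJS hJframe hparJ' hregIJ
    rw [hcomm] at hattI hlabI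
    rw [hpteq] at hattI hlabI
    have huJx'' : nb (nb (nb x t₁) b') (c'' - a'') = nb (nb x t₂) cJ := hattI
    -- bonds at `x''`
    have hbu'uJ : nb (nb x t₂) cJ ∈ shell S u' := by
      have := (bond_nb_iff hch hx''S hc2'' hc1'').2 (by
        rw [show c'' - b'' - (c'' - a'') = a'' - b'' by abel]; exact h12x)
      rwa [hu'x'', huJx''] at this
    have hbx''u' : u' ∈ shell S (nb (nb x t₁) b') := by
      rw [← hu'x'']; exact (nb_mem hch hx''S hc2'').2
    have huJS : nb (nb x t₂) cJ ∈ S := by rw [← huJx'']; exact (nb_mem hch hx''S hc1'').1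
    have hβ := zlab_spec hch hu'S huJS hbu'uJ
    -- `ζ' = ξ' + t₂''` labels `x''`, `η' = ξ' + t₁''` labels `IIx = nb y a' = nb x'' (a'' − b'')`
    have hζ'P : zlab Pc nb u' (nb x t₁) + t₂'' ∈ Pc u' := by
      have : zlab Pc nb u' (nb x t₁) + t₂'' ∈ lowerCap (Pc u') t₁'' t₂''
          (Vstep Pc nb ⟨nb x t₁, a', b', U'⟩).U := by rw [hL']; simp
      exact (mem_lowerCap_iff.1 this).1
    have hη'P : zlab Pc nb u' (nb x t₁) + t₁'' ∈ Pc u' := by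
      have : zlab Pc nb u' (nb x t₁) + t₁'' ∈ lowerCap (Pc u') t₁'' t₂''
          (Vstep Pc nb ⟨nb x t₁, a', b', U'⟩).U := by rw [hL']; simp
      exact (mem_lowerCap_iff.1 this).1
    have hζ' : zlab Pc nb u' (nb (nb x t₁) b') = zlab Pc nb u' (nb x t₁) + t₂'' := by
      rw [← hnJ']; exact zlab_nb hch hu'S hζ'P
    have hη' : zlab Pc nb u' (nb (nb x t₁) a') = zlab Pc nb u' (nb x t₁) + t₁'' := by
      rw [← hnI']; exact zlab_nb hch hu'S hη'P
    have hbu'II : nb (nb x t₁) a' ∈ shell S u' := by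
      rw [← hnI']; exact (nb_mem hch hu'S hη'P).2
    have hIIx'' : nb (nb (nb x t₁) b') (a'' - b'') = nb (nb x t₁) a' := by
      have e : a'' - b'' = zlab Pc nb (nb (nb x t₁) b') (nb (nb x t₁) a') := by
        show (zlab Pc nb (nb (nb x t₁) b') (nb (nb x t₁) a') - zlab Pc nb (nb (nb x t₁) b') (nb x t₁)) -
          -zlab Pc nb (nb (nb x t₁) b') (nb x t₁) = _
        abel
      rw [e]; exact hv''nb
    have hab''P : a'' - b'' ∈ Pc (nb (nb x t₁) b') :=
      hhexx (mem_hexLabels_iff.2 (Or.inr (Or.inr (Or.inr (Or.inr (Or.inr rfl))))))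
    -- distances at `u'`
    have Dβζ : sqNormInt (zlab Pc nb u' (nb (nb x t₂) cJ) - zlab Pc nb u' (nb (nb x t₁) b')) = 18 := by
      have h := transfer_nb_centre hch hsy hx''S hu'S hbx''u' hc1'' (by rw [huJx'']; exact hbu'uJ)
      rw [huJx''] at h
      rw [h]; exact zchart_sqNormInt_eq (hch _ hx''S) hc1''
    have Dβη : sqNormInt (zlab Pc nb u' (nb (nb x t₂) cJ) - zlab Pc nb u' (nb (nb x t₁) a')) = 54 := by
      have h := transfer_nb_nb hch hsy hx''S hu'S hbx''u' hc1'' hab''P (by rw [huJx'']; exact hbu'uJ)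
        (by rw [hIIx'']; exact hbu'II)
      rw [huJx'', hIIx''] at h
      rw [h]
      exact (dist_evenCap_ca (Pc (nb (nb x t₁) b')) hPx'' a'' ha''P b'' hb''P c'' hc''P h12x hhexx
        hc''off hc1'' hc2'').2.2.2.2.2
    have hβeq : zlab Pc nb u' (nb (nb x t₂) cJ) = t₂'' - t₁'' := by
      have h := label_third_vertex (Pc u') hPu' (zlab Pc nb u' (nb x t₁) + t₁'') hη'P
        (zlab Pc nb u' (nb x t₁) + t₂'') hζ'P _ hβ.1
        (by rw [show zlab Pc nb u' (nb x t₁) + t₁'' - (zlab Pc nb u' (nb x t₁) + t₂'') = t₁'' - t₂'' by abel]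
            exact Dt12)
        (by rw [← hζ']; exact Dβζ) (by rw [← hη']; exact Dβη)
        (by rw [show zlab Pc nb u' (nb x t₁) + t₂'' - (zlab Pc nb u' (nb x t₁) + t₁'') = t₂'' - t₁'' by abel]
            exact ht21P)
      rw [h]; abel
    exact ⟨hβeq, hbu'uJ⟩
  · /- ODD: everything is read in the chart of `x` -/
    have hpar' : frameParity a' b' U' = -1 := hparI.trans hpar
    rcases hbr' with ⟨hpar'', -, -, -, -⟩ | ⟨-, hL', hnI', hnJ', -⟩
    · rw [hpar'] at hpar''; norm_num at hpar''
    obtain ⟨-, -, hcoff, hc1, hc2, hO⟩ := odd_form_of_parity hPx hU hpar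
    obtain ⟨hattI, -⟩ := attach_I_odd hch hsy hx hU hpar hregI
    obtain ⟨hattJ, -⟩ := attach_J_odd hch hsy hx hU hpar hregJ
    rw [hIeq] at hattI
    rw [hJeq] at hattJ
    have hu'x : nb x (c + t₁) = u' := hattI.symm
    have huJx : nb (nb x t₂) cJ = nb x (c + t₂) := hattJ
    rw [huJx]
    -- `η'⁻ = ξ' − t₁''` labels `x`, `ζ'⁻ = ξ' − t₂''` labels `z = nb y (−b') = nb x (t₁ − t₂)`
    have hyx : nb (nb x t₁) (-a') = x := by
      show nb (nb x t₁) (-(-zlab Pc nb (nb x t₁) x)) = x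
      rw [neg_neg]; exact hwx
    have hyz : nb (nb x t₁) (-b') = nb x (t₁ - t₂) := by
      have e : -b' = zlab Pc nb (nb x t₁) (nb x (t₁ - t₂)) := by
        rw [hκ]
        show -(zlab Pc nb (nb x t₁) (nb x t₂) - zlab Pc nb (nb x t₁) x) = _
        abel
      rw [e]
      exact (zlab_spec hch hyS (nb_mem hch hx ht12).1 ((bond_nb_iff hch hx ht₁ ht12).2
        (dist_hexagon (Pc x) hPx t₁ ht₁ t₂ ht₂ h12 hhex).2.2.2.2.2.1)).2
    have hη'P : zlab Pc nb u' (nb x t₁) - t₁'' ∈ Pc u' := by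
      have : zlab Pc nb u' (nb x t₁) - t₁'' ∈ lowerCap (Pc u') t₁'' t₂''
          (Vstep Pc nb ⟨nb x t₁, a', b', U'⟩).U := by rw [hL']; simp
      exact (mem_lowerCap_iff.1 this).1
    have hζ'P : zlab Pc nb u' (nb x t₁) - t₂'' ∈ Pc u' := by
      have : zlab Pc nb u' (nb x t₁) - t₂'' ∈ lowerCap (Pc u') t₁'' t₂''
          (Vstep Pc nb ⟨nb x t₁, a', b', U'⟩).U := by rw [hL']; simp
      exact (mem_lowerCap_iff.1 this).1
    have hη' : zlab Pc nb u' x = zlab Pc nb u' (nb x t₁) - t₁'' := by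
      have h : zlab Pc nb u' (nb (nb x t₁) (-a')) = zlab Pc nb u' (nb x t₁) - t₁'' := by
        rw [← hnI']; exact zlab_nb hch hu'S hη'P
      rwa [hyx] at h
    have hζ' : zlab Pc nb u' (nb x (t₁ - t₂)) = zlab Pc nb u' (nb x t₁) - t₂'' := by
      have h : zlab Pc nb u' (nb (nb x t₁) (-b')) = zlab Pc nb u' (nb x t₁) - t₂'' := by
        rw [← hnJ']; exact zlab_nb hch hu'S hζ'P
      rwa [hyz] at h
    -- bonds at `x`
    have hbxu' : u' ∈ shell S x := by
      rw [← hu'x]; exact (nb_mem hch hx hc1).2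
    have hbu'uJ : nb x (c + t₂) ∈ shell S u' := by
      have := (bond_nb_iff hch hx hc1 hc2).2 (by
        rw [show c + t₁ - (c + t₂) = t₁ - t₂ by abel]; exact h12)
      rwa [hu'x] at this
    have hbu'z : nb x (t₁ - t₂) ∈ shell S u' := by
      have h : nb (nb x t₁) (-b') ∈ shell S u' := by
        rw [← hnJ']; exact (nb_mem hch hu'S hζ'P).2
      rwa [hyz] at h
    have huJS : nb x (c + t₂) ∈ S := (nb_mem hch hx hc2).1
    have hβ := zlab_spec hch hu'S huJS hbu'uJ
    have Dβη : sqNormInt (zlab Pc nb u' (nb x (c + t₂)) - zlab Pc nb u' x) = 18 := by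
      rw [transfer_nb_centre hch hsy hx hu'S hbxu' hc2 hbu'uJ]; exact zchart_sqNormInt_eq (hch x hx) hc2
    have Dβζ : sqNormInt (zlab Pc nb u' (nb x (c + t₂)) - zlab Pc nb u' (nb x (t₁ - t₂))) = 54 := by
      rw [transfer_nb_nb hch hsy hx hu'S hbxu' hc2 ht12 hbu'uJ hbu'z]
      exact (dist_oddCap_cb (Pc x) hPx t₁ ht₁ t₂ ht₂ c hcP h12 hhex hcoff hc1 hc2).2.2.2.2.2
    have hβeq : zlab Pc nb u' (nb x (c + t₂)) = t₂'' - t₁'' := by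
      have h := label_third_vertex (Pc u') hPu' (zlab Pc nb u' (nb x t₁) - t₂'') hζ'P
        (zlab Pc nb u' (nb x t₁) - t₁'') hη'P _ hβ.1
        (by rw [show zlab Pc nb u' (nb x t₁) - t₂'' - (zlab Pc nb u' (nb x t₁) - t₁'') = t₁'' - t₂'' by abel]
            exact Dt12)
        (by rw [← hη']; exact Dβη) (by rw [← hζ']; exact Dβζ)
        (by rw [show zlab Pc nb u' (nb x t₁) - t₁'' - (zlab Pc nb u' (nb x t₁) - t₂'') = t₂'' - t₁'' by abel]
            exact ht21P)
      rw [h]; abel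
    exact ⟨hβeq, hbu'uJ⟩

/-- **`V ∘ J`, the point** (from `Vstep_Istep_pt` by the swap symmetry): the apex site over `Jx`
is the `t₂`-neighbour of `V g`. [folklore] -/
theorem Vstep_Jstep_pt (hch : ∀ z ∈ S, IsZChart S z (Pc z) (Ac z) (nb z))
    (hsy : ∀ x ∈ S, ∀ y ∈ shell S x, x ∈ shell S y) {x : (EuclideanSpace ℝ (Fin 3))}
    (hx : x ∈ S) {t₁ t₂ : Fin 3 → ℤ} {U : Finset (Fin 3 → ℤ)} (hU : IsFrame (Pc x) t₁ t₂ U)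
    (hI : IsFrame (Pc (nb x t₁)) (Istep Pc nb ⟨x, t₁, t₂, U⟩).t₁ (Istep Pc nb ⟨x, t₁, t₂, U⟩).t₂
      (Istep Pc nb ⟨x, t₁, t₂, U⟩).U)
    (hJ : IsFrame (Pc (nb x t₂)) (Jstep Pc nb ⟨x, t₁, t₂, U⟩).t₁ (Jstep Pc nb ⟨x, t₁, t₂, U⟩).t₂
      (Jstep Pc nb ⟨x, t₁, t₂, U⟩).U)
    (hIi : IsFrame (Pc (nb x (-t₁))) (IinvStep Pc nb ⟨x, t₁, t₂, U⟩).t₁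
      (IinvStep Pc nb ⟨x, t₁, t₂, U⟩).t₂ (IinvStep Pc nb ⟨x, t₁, t₂, U⟩).U)
    (hJi : IsFrame (Pc (nb x (-t₂))) (JinvStep Pc nb ⟨x, t₁, t₂, U⟩).t₁
      (JinvStep Pc nb ⟨x, t₁, t₂, U⟩).t₂ (JinvStep Pc nb ⟨x, t₁, t₂, U⟩).U) :
    (Vstep Pc nb (Jstep Pc nb ⟨x, t₁, t₂, U⟩)).pt =
        nb (Vstep Pc nb ⟨x, t₁, t₂, U⟩).pt (Vstep Pc nb ⟨x, t₁, t₂, U⟩).t₂ ∧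
      (Vstep Pc nb (Jstep Pc nb ⟨x, t₁, t₂, U⟩)).pt ∈ shell S (Vstep Pc nb ⟨x, t₁, t₂, U⟩).pt ∧
      zlab Pc nb (Vstep Pc nb ⟨x, t₁, t₂, U⟩).pt (Vstep Pc nb (Jstep Pc nb ⟨x, t₁, t₂, U⟩)).pt =
        (Vstep Pc nb ⟨x, t₁, t₂, U⟩).t₂ := by
  have hPx := pattern_cases hch hx
  obtain ⟨hI', hJ', hIi', hJi'⟩ := swap_hyps (Pc := Pc) (nb := nb) hI hJ hIi hJi
  have hU' : IsFrame (Pc x) t₂ t₁ U := isFrame_swap hU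
  obtain ⟨h1, h2, h3⟩ := Vstep_Istep_pt hch hsy hx hU' hI' hJ' hIi' hJi'
  -- the frame `I ⟨x, t₂, t₁, U⟩` is valid, so `V` commutes with the swap there
  have hregI' := hregI_of_valid (Pc := Pc) (nb := nb) hI'
  obtain ⟨hyS, -, -, -, -, -, -, -, -, -, -, hframe', -⟩ := Istep_spec hch hsy hx hU' hregI'
  have hPy := pattern_cases hch hyS
  have hVJ : (Vstep Pc nb (Jstep Pc nb ⟨x, t₁, t₂, U⟩)).pt = (Vstep Pc nb (Istep Pc nb ⟨x, t₂, t₁, U⟩)).pt := by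
    rw [Jstep_swap]
    have h4 := congrArg ZFrame.pt (Vstep_swap (nb := nb) hPy hframe')
    exact h4
  rw [Vstep_swap hPx hU] at h1 h2 h3
  rw [hVJ]
  exact ⟨h1, h2, h3⟩

/-! ## Anchor -/

/-- Anchor (registered sub-goal of stmt-AtomisticToContinuum-12088, toward `develop_transport`):
for a valid frame whose four in-layer transports are valid, the apex site over `Jx` is the
`t₂`-neighbour of the frame `V g` at the apex site over `x` and a shell point of the latter
(explicit form of the first two conjuncts of `Vstep_Jstep_pt`). [folklore] -/
theorem transportComm2_anchor : ∀ (S : Set (EuclideanSpace ℝ (Fin 3))) (Pc : EuclideanSpace ℝ (Fin 3) → Finset (Fin 3 → ℤ)) (Ac : EuclideanSpace ℝ (Fin 3) → (EuclideanSpace ℝ (Fin 3) →ₗᵢ[ℝ] EuclideanSpace ℝ (Fin 3))) (nb : EuclideanSpace ℝ (Fin 3) → (Fin 3 → ℤ) → EuclideanSpace ℝ (Fin 3)), (∀ z ∈ S, IsZChart S z (Pc z) (Ac z) (nb z)) → (∀ x ∈ S, ∀ y ∈ shell S x, x ∈ shell S y) → ∀ x ∈ S, ∀ (t₁ t₂ :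 Fin 3 → ℤ) (U : Finset (Fin 3 → ℤ)), IsFrame (Pc x) t₁ t₂ U → IsFrame (Pc (nb x t₁)) (Istep Pc nb ⟨x, t₁, t₂, U⟩).t₁ (Istep Pc nb ⟨x, t₁, t₂, U⟩).t₂ (Istep Pc nb ⟨x, t₁, t₂, U⟩).U → IsFrame (Pc (nb x t₂)) (Jstep Pc nb ⟨x, t₁, t₂, U⟩).t₁ (Jstep Pc nb ⟨x, t₁, t₂, U⟩).t₂ (Jstep Pc nb ⟨x, t₁, t₂, U⟩).U → IsFrame (Pc (nb x (-t₁))) (IinvStep Pc nb ⟨x, t₁, t₂, U⟩).t₁ (IinvStep Pc nb ⟨x, t₁, t₂, U⟩).t₂ (IinvStep Pc nb ⟨x, t₁, t₂, U⟩).U → IsFrame (Pc (nb x (-t₂))) (JinvStep Pc nb ⟨x, t₁, t₂, U⟩).t₁ (JinvStep Pc nb ⟨x, t₁, t₂, U⟩).t₂ (JinvStep Pc nb ⟨x, t₁, t₂, U⟩).U → (Vstep Pc nb (Jstep Pc nb ⟨x, t₁, t₂, U⟩)).pt = nb (Vstep Pc nb ⟨x, t₁, t₂, U⟩).pt (Vstep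 Pc nb ⟨x, t₁, t₂, U⟩).t₂ ∧ (Vstep Pc nb (Jstep Pc nb ⟨x, t₁, t₂, U⟩)).pt ∈ shell S (Vstep Pc nb ⟨x, t₁, t₂, U⟩).pt :=
  fun _ _ _ _ hch hsy _ hx _ _ _ hU hI hJ hIi hJi =>
    ⟨(Vstep_Jstep_pt hch hsy hx hU hI hJ hIi hJi).1, (Vstep_Jstep_pt hch hsy hx hU hI hJ hIi hJi).2.1⟩

end Summit.AtomisticToContinuum.Crystallization.Theorems.HullExactificationCascadeRobustBarlowTemplate

end
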